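import Summits.Ventures.PercRepro.RankLevelSetLevelFour
import Summits.Ventures.PercRepro.SevenThreeQThree

/-!
# PercRepro — THEOREM C₄, UNCONDITIONAL: C-025 at level `4` for every finite matroid and every `p ≥ 60`
(night-1, gen 4)

`proofs/NIGHT-1-C025-induction.md` §15. `c025_four_of_three` (RankLevelSetLevelFour) composed with the q = 3 row
`c025_three_all` (p3, SevenThreeQThree; ADDENDUM 19). Axioms: standard.
-/

open scoped Matroid

namespace PercRepro

namespace ThmN

variable {α : Type}

/-- **THEOREM C₄**: every finite matroid satisfies C-025 at level `4` for every `p ≥ 60`: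
`Φ(p, 4) · #{A ⊆ E : r(A) = p, r(E ∖ A) = 4} ≤ #{A ⊆ E : 4 < r(A) < p}` — no corank restriction, explicit threshold. -/
theorem c025_four_large (M : Matroid α) [M.Finite] (p : ℕ) (hp : 60 ≤ p) : RLS M p 4 :=
  c025_four_of_three (fun M _ p hp => SevenThree.c025_three_all M p hp) M p hp

/-- The level-`4` statement in the vocabulary of `C025`. -/
theorem c025_four_large' (M : Matroid α) [M.Finite] (p : ℕ) (hp : 60 ≤ p) :
    phiK p 4 * ({A : Set α | A ⊆ M.E ∧ M.eRk A = (p : ℕ∞) ∧ M.eRk (M.E \ A) = (4 : ℕ∞)}.ncard : ℚ) ≤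
      ({A : Set α | A ⊆ M.E ∧ (4 : ℕ∞) < M.eRk A ∧ M.eRk A < (p : ℕ∞)}.ncard : ℚ) :=
  c025_four_large M p hp

end ThmN

end PercRepro
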